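import Literature.Computability.AlgebraicComplexity.DegenerationSpectralMonotone
import HarnessLib

/-!
# Isolated summands (Alman–Li 2026, §5.2.1: the definition, Prop. 5.1, Prop. 5.2)

Topic `Literature/Computability/AlgebraicComplexity` (family `MatrixMultiplication`). Source: J. Alman,
B. Li, *Asymptotic Rank Speedup Theorems, Revisited*, arXiv:2605.21738 (2026), §5.2.1 (held text
`paper:arxiv-2605.21738`, p0013 L17–39):

"Let `T ⊕ T' ⊴ S` be a degeneration defined by the polynomial maps `A_λ, B_λ`, and `C_λ`. Let
`R_λ = (A_λ ⊗ B_λ ⊗ C_λ)S` denote the `𝔽(λ)`-tensor prior to taking the limit `λ → 0`. By definition,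
we must have `(R_λ)_{111} = T + O(λ)` and `(R_λ)_{222} = T' + O(λ)`, while all other blocks
`(R_λ)_{ijk}` (where indices are not all `1` or all `2`) must satisfy `(R_λ)_{ijk} = O(λ)`. We say that
the direct summand `T'` is an *isolated summand in the third mode* with respect to the degeneration
`(A_λ, B_λ, C_λ)` if `(R_λ)_{ij2}` is identically zero for all `(i, j) ≠ (2, 2)`." (a property going
back to Coppersmith–Winograd 1982, "crucial for iterating speedup theorems").
**Proposition 5.1.** "The direct summand `T'` of `T ⊕ T' ⊴ S` produced by (thm:freelunch_speedup)
[Thm. 5.1] or (cor:freelunch_speedup_degen) [Cor. 5.1] is isolated in the third mode."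
**Proposition 5.2.** "Let `T₁', T₂'` be isolated direct summands of degenerations `T₁ ⊕ T₁' ⊴ S₁`,
`T₂ ⊕ T₂' ⊴ S₂`. Then, in the tensor product of these degenerations
`(T₁ ⊗ T₂) ⊕ (T₁ ⊗ T₂') ⊕ (T₁' ⊗ T₂) ⊕ (T₁' ⊗ T₂') ⊴ S₁ ⊗ S₂`, the term `T₁' ⊗ T₂'` remains an
isolated summand in the third mode."

This file, in the tree's coordinates for degenerations (`IsApproxRestriction`,
`DegenerationSpectralMonotone.lean`: polynomial matrices `A ∈ K[ε]^{ρ₁ × ι}`, `B`, `C` acting on `S`,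
entries `∑_{a,b,c} A_{r₁a} B_{r₂b} C_{r₃c} S_{abc} ∈ K[ε]`):
* `AlmanLi2026.IsIsolatedThird S A B C P₁ P₂ P₃` — the definition, with the summand `T'` located by
  the row predicates `P₁, P₂, P₃` ("index `2`" in each mode): every entry with third index in `T'`'s
  block and `(first, second)` indices NOT both in `T'`'s blocks vanishes identically in `K[ε]`;
* `AlmanLi2026.prop51`, `AlmanLi2026.prop51_degen` — Prop. 5.1 for the explicit matrices of the
  tree's `isApproxRestriction_freeLunch` (Thm. 5.1: `(A ; εA'), (B ; εB'), (ε²C ; C')`) and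
  `isApproxRestriction_freeLunch_degen` (Cor. 5.1: `(A ; ε^{h+1}A'), (B ; ε^{h+1}B'),
  (ε^{h+h'+2}C ; C')`) of `AlmanLi2026FreeLunchSpeedup.lean` (restated inline here; that module is
  not imported): the three vanishing hypotheses of Thm. 5.1 are exactly the three off-diagonal blocks;
* `AlmanLi2026.prop52` — Prop. 5.2 for the Kronecker-product matrices of
  `IsApproxRestriction.kronecker` (BCS (15.25)): a product block factors as the product of the two
  blocks, one of which is off-diagonal.
Everything over a commutative semiring; no named facts.

## References

* J. Alman, B. Li, *Asymptotic Rank Speedup Theorems, Revisited*, arXiv:2605.21738 (2026), §5.2.1,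
  Props. 5.1, 5.2 (held text p0013 L17–39). [AlmanLi2026]
* D. Coppersmith, S. Winograd, *On the asymptotic complexity of matrix multiplication*, SIAM J.
  Comput. 11 (1982) 472–492 (the original isolated/full slices). [CoppersmithWinograd1982]
* P. Bürgisser, M. Clausen, M. A. Shokrollahi, *Algebraic Complexity Theory* (1997), (15.19),
  (15.25) (degenerations in coordinates and their tensor products). [BurgisserClausenShokrollahi1997]
-/

noncomputable section

open scoped BigOperators Polynomial
open Polynomial

namespace Literature.Computability.AlgebraicComplexity

universe u

variable {K : Type u} [CommSemiring K]
variable {ι κ μ ι' κ' μ' α β ν ρ₁ ρ₂ ρ₃ : Type*}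

namespace AlmanLi2026

/-! ## The definition -/

/-- **Isolated summand in the third mode** (Alman–Li 2026, §5.2.1, after Coppersmith–Winograd 1982):
for polynomial degeneration data `A ∈ K[ε]^{ρ₁×ι}, B ∈ K[ε]^{ρ₂×κ}, C ∈ K[ε]^{ρ₃×μ}` acting on `S`
(`R_ε = (A ⊗ B ⊗ C) S`), and a direct summand `T'` of the target occupying the rows singled out by
`P₁, P₂, P₃` in the three modes, `T'` is *isolated in the third mode* when every block `(R_ε)_{ij2}`
with `(i, j) ≠ (2, 2)` vanishes identically: for all rows `r₃` of `T'`'s third-mode block and all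
`(r₁, r₂)` not both in `T'`'s blocks, `∑_{a,b,c} A_{r₁a} B_{r₂b} C_{r₃c} S_{abc} = 0` in `K[ε]`.
[cite: AlmanLi2026, §5.2.1 (definition before Prop. 5.1)] -/
def IsIsolatedThird [Fintype ι] [Fintype κ] [Fintype μ] (S : ι → κ → μ → K)
    (A : ρ₁ → ι → K[X]) (B : ρ₂ → κ → K[X]) (C : ρ₃ → μ → K[X])
    (P₁ : ρ₁ → Prop) (P₂ : ρ₂ → Prop) (P₃ : ρ₃ → Prop) : Prop :=
  ∀ r₁ r₂ r₃, P₃ r₃ → ¬(P₁ r₁ ∧ P₂ r₂) →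
    (∑ a, ∑ b, ∑ c, A r₁ a * B r₂ b * C r₃ c * Polynomial.C (S a b c)) = 0

/-- Unfolding `IsIsolatedThird`. [cite: AlmanLi2026, §5.2.1] -/
theorem isIsolatedThird_iff [Fintype ι] [Fintype κ] [Fintype μ] (S : ι → κ → μ → K)
    (A : ρ₁ → ι → K[X]) (B : ρ₂ → κ → K[X]) (C : ρ₃ → μ → K[X])
    (P₁ : ρ₁ → Prop) (P₂ : ρ₂ → Prop) (P₃ : ρ₃ → Prop) :
    IsIsolatedThird S A B C P₁ P₂ P₃ ↔
      ∀ r₁ r₂ r₃, P₃ r₃ → ¬(P₁ r₁ ∧ P₂ r₂) →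
        (∑ a, ∑ b, ∑ c, A r₁ a * B r₂ b * C r₃ c * Polynomial.C (S a b c)) = 0 :=
  Iff.rfl

/-- Isolation only depends on the blocks: it persists when the `T'`-blocks of the first two modes
are enlarged and the `T'`-block of the third mode is shrunk. [cite: AlmanLi2026, §5.2.1] -/
theorem IsIsolatedThird.mono [Fintype ι] [Fintype κ] [Fintype μ] {S : ι → κ → μ → K}
    {A : ρ₁ → ι → K[X]} {B : ρ₂ → κ → K[X]} {C : ρ₃ → μ → K[X]}
    {P₁ P₁' : ρ₁ → Prop} {P₂ P₂' : ρ₂ → Prop} {P₃ P₃' : ρ₃ → Prop}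
    (h : IsIsolatedThird S A B C P₁ P₂ P₃) (h₁ : ∀ r, P₁ r → P₁' r) (h₂ : ∀ r, P₂ r → P₂' r)
    (h₃ : ∀ r, P₃' r → P₃ r) : IsIsolatedThird S A B C P₁' P₂' P₃' :=
  fun r₁ r₂ r₃ hr₃ hr₁₂ => h r₁ r₂ r₃ (h₃ _ hr₃) fun hp => hr₁₂ ⟨h₁ _ hp.1, h₂ _ hp.2⟩

/-! ## Prop. 5.1: the free-lunch summand is isolated -/

/-- One block of `(Â ⊗ B̂ ⊗ Ĉ) S` for monomially weighted CONSTANT matrices: weights multiply,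
coefficients contract (as in `AlmanLi2026FreeLunchSpeedup`). [folklore] -/
private theorem sum_weighted_eq' [Fintype ι] [Fintype κ] [Fintype μ] (eA eB eC : ℕ) (P : ι → K)
    (Q : κ → K) (R : μ → K) (S : ι → κ → μ → K) :
    (∑ a, ∑ b, ∑ c, (Polynomial.C (P a) * X ^ eA) * (Polynomial.C (Q b) * X ^ eB) *
        (Polynomial.C (R c) * X ^ eC) * Polynomial.C (S a b c)) =
      Polynomial.C (∑ a, ∑ b, ∑ c, P a * Q b * R c * S a b c) * X ^ (eA + eB + eC) := by
  simp only [map_sum, Finset.sum_mul]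
  refine Finset.sum_congr rfl fun a _ => Finset.sum_congr rfl fun b _ =>
    Finset.sum_congr rfl fun c _ => ?_
  simp only [map_mul, pow_add]
  ring

/-- One block of `(Â ⊗ B̂ ⊗ Ĉ) S` for monomially re-weighted POLYNOMIAL matrices (as in
`AlmanLi2026FreeLunchSpeedup`). [folklore] -/
private theorem sum_weighted_poly_eq' [Fintype ι] [Fintype κ] [Fintype μ] (eA eB eC : ℕ)
    (P : ι → K[X]) (Q : κ → K[X]) (R : μ → K[X]) (S : ι → κ → μ → K) :
    (∑ a, ∑ b, ∑ c, (P a * X ^ eA) * (Q b * X ^ eB) * (R c * X ^ eC) * Polynomial.C (S a b c)) =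
      X ^ (eA + eB + eC) * ∑ a, ∑ b, ∑ c, P a * Q b * R c * Polynomial.C (S a b c) := by
  simp only [Finset.mul_sum]
  refine Finset.sum_congr rfl fun a _ => Finset.sum_congr rfl fun b _ =>
    Finset.sum_congr rfl fun c _ => ?_
  simp only [pow_add]
  ring

/-- **Alman–Li 2026, Prop. 5.1 (for Thm. 5.1's construction).** With the three vanishing conditions
of Thm. 5.1 — `(A ⊗ B ⊗ C') S = 0`, `(A' ⊗ B ⊗ C') S = 0`, `(A ⊗ B' ⊗ C') S = 0` — the summand
`T' = (A' ⊗ B' ⊗ C') S` of the explicit free-lunch degeneration `Â = (A ; εA')`, `B̂ = (B ; εB')`,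
`Ĉ = (ε²C ; C')` (the matrices of `AlmanLi2026.isApproxRestriction_freeLunch`) is isolated in the
third mode: the blocks `112`, `212`, `122` of `(Â ⊗ B̂ ⊗ Ĉ) S` are these three conditions.
[cite: AlmanLi2026, Prop. 5.1] -/
theorem prop51 [Fintype ι] [Fintype κ] [Fintype μ] {S : ι → κ → μ → K}
    {A : ι' → ι → K} {B : κ' → κ → K} (C₀ : μ' → μ → K) (A' : α → ι → K) (B' : β → κ → K)
    {C' : ν → μ → K}
    (hC' : ∀ a' b' z, (∑ a, ∑ b, ∑ c, A a' a * B b' b * C' z c * S a b c) = 0)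
    (hA' : ∀ x b' z, (∑ a, ∑ b, ∑ c, A' x a * B b' b * C' z c * S a b c) = 0)
    (hB' : ∀ a' y z, (∑ a, ∑ b, ∑ c, A a' a * B' y b * C' z c * S a b c) = 0) :
    IsIsolatedThird S
      (fun r a => Sum.elim (fun a' => Polynomial.C (A a' a) * X ^ 0)
        (fun x => Polynomial.C (A' x a) * X ^ 1) r)
      (fun r b => Sum.elim (fun b' => Polynomial.C (B b' b) * X ^ 0)
        (fun y => Polynomial.C (B' y b) * X ^ 1) r)
      (fun r c => Sum.elim (fun c' => Polynomial.C (C₀ c' c) * X ^ 2)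
        (fun z => Polynomial.C (C' z c) * X ^ 0) r)
      (fun r => Sum.isRight r = true) (fun r => Sum.isRight r = true)
      (fun r => Sum.isRight r = true) := by
  rintro r₁ r₂ (c' | z) h₃ h₁₂
  · simp at h₃
  rcases r₁ with a' | x <;> rcases r₂ with b' | y <;>
    simp only [Sum.elim_inl, Sum.elim_inr, sum_weighted_eq']
  · rw [hC']; simp
  · rw [hB']; simp
  · rw [hA']; simp
  · simp at h₁₂

/-- **Alman–Li 2026, Prop. 5.1 (for Cor. 5.1's construction).** The same for degeneration data:
with the three vanishing conditions exact over `K[ε]`, the summand of the explicit degeneration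
`Â = (A ; ε^{h+1}A')`, `B̂ = (B ; ε^{h+1}B')`, `Ĉ = (ε^{h+h'+2}C ; C')` (the matrices of
`AlmanLi2026.isApproxRestriction_freeLunch_degen`) is isolated in the third mode.
[cite: AlmanLi2026, Prop. 5.1] -/
theorem prop51_degen [Fintype ι] [Fintype κ] [Fintype μ] (h h' : ℕ) {S : ι → κ → μ → K}
    {A : ι' → ι → K[X]} {B : κ' → κ → K[X]} (C₀ : μ' → μ → K[X]) (A' : α → ι → K[X])
    (B' : β → κ → K[X]) {C' : ν → μ → K[X]}
    (hC' : ∀ a' b' z, (∑ a, ∑ b, ∑ c, A a' a * B b' b * C' z c * Polynomial.C (S a b c)) = 0)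
    (hA' : ∀ x b' z, (∑ a, ∑ b, ∑ c, A' x a * B b' b * C' z c * Polynomial.C (S a b c)) = 0)
    (hB' : ∀ a' y z, (∑ a, ∑ b, ∑ c, A a' a * B' y b * C' z c * Polynomial.C (S a b c)) = 0) :
    IsIsolatedThird S
      (fun r a => Sum.elim (fun a' => A a' a * X ^ 0) (fun x => A' x a * X ^ (h + 1)) r)
      (fun r b => Sum.elim (fun b' => B b' b * X ^ 0) (fun y => B' y b * X ^ (h + 1)) r)
      (fun r c => Sum.elim (fun c' => C₀ c' c * X ^ (h + h' + 2)) (fun z => C' z c * X ^ 0) r)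
      (fun r => Sum.isRight r = true) (fun r => Sum.isRight r = true)
      (fun r => Sum.isRight r = true) := by
  rintro r₁ r₂ (c' | z) h₃ h₁₂
  · simp at h₃
  rcases r₁ with a' | x <;> rcases r₂ with b' | y <;>
    simp only [Sum.elim_inl, Sum.elim_inr, sum_weighted_poly_eq']
  · rw [hC']; simp
  · rw [hB']; simp
  · rw [hA']; simp
  · simp at h₁₂

/-! ## Prop. 5.2: products of isolated summands are isolated -/

/-- A block of the Kronecker-product data factors as the product of the two blocks (the computation
inside `IsApproxRestriction.kronecker`, BCS (15.25)). [cite: BurgisserClausenShokrollahi1997, (15.25)] -/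
private theorem sum_kronecker_block_eq [Fintype ι] [Fintype κ] [Fintype μ] {ι₁ κ₁ μ₁ : Type*}
    [Fintype ι₁] [Fintype κ₁] [Fintype μ₁] {σ₁ σ₂ σ₃ : Type*} (S : ι → κ → μ → K)
    (S₁ : ι₁ → κ₁ → μ₁ → K) (A : ρ₁ → ι → K[X]) (B : ρ₂ → κ → K[X]) (C : ρ₃ → μ → K[X])
    (A₁ : σ₁ → ι₁ → K[X]) (B₁ : σ₂ → κ₁ → K[X]) (C₁ : σ₃ → μ₁ → K[X]) (x : ρ₁ × σ₁)
    (y : ρ₂ × σ₂) (z : ρ₃ × σ₃) :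
    (∑ a : ι × ι₁, ∑ b : κ × κ₁, ∑ c : μ × μ₁, A x.1 a.1 * A₁ x.2 a.2 *
      (B y.1 b.1 * B₁ y.2 b.2) * (C z.1 c.1 * C₁ z.2 c.2) *
        Polynomial.C (kroneckerTensor S S₁ a b c)) =
      (∑ a, ∑ b, ∑ c, A x.1 a * B y.1 b * C z.1 c * Polynomial.C (S a b c)) *
        ∑ a, ∑ b, ∑ c, A₁ x.2 a * B₁ y.2 b * C₁ z.2 c * Polynomial.C (S₁ a b c) := by
  simp only [Fintype.sum_prod_type, kroneckerTensor_apply, Polynomial.C_mul]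
  simp only [Finset.sum_mul_sum]
  refine Finset.sum_congr rfl fun a _ => Finset.sum_congr rfl fun a₁ _ =>
    Finset.sum_congr rfl fun b _ => Finset.sum_congr rfl fun b₁ _ =>
    Finset.sum_congr rfl fun c _ => Finset.sum_congr rfl fun c₁ _ => ?_
  ring

/-- **Alman–Li 2026, Prop. 5.2.** If `T₁'` is isolated in the third mode w.r.t. `(A, B, C)` on `S₁`
and `T₂'` w.r.t. `(A₁, B₁, C₁)` on `S₂`, then `T₁' ⊗ T₂'` — the summand occupying the rows in BOTH
`T'`-blocks in each mode — is isolated in the third mode w.r.t. the Kronecker-product data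
`(A ⊗ A₁, B ⊗ B₁, C ⊗ C₁)` on `S₁ ⊗ S₂` (the matrices of `IsApproxRestriction.kronecker`).
[cite: AlmanLi2026, Prop. 5.2] -/
theorem prop52 [Fintype ι] [Fintype κ] [Fintype μ] {ι₁ κ₁ μ₁ : Type*} [Fintype ι₁] [Fintype κ₁]
    [Fintype μ₁] {σ₁ σ₂ σ₃ : Type*} {S : ι → κ → μ → K} {S₁ : ι₁ → κ₁ → μ₁ → K}
    {A : ρ₁ → ι → K[X]} {B : ρ₂ → κ → K[X]} {C : ρ₃ → μ → K[X]}
    {A₁ : σ₁ → ι₁ → K[X]} {B₁ : σ₂ → κ₁ → K[X]} {C₁ : σ₃ → μ₁ → K[X]}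
    {P₁ : ρ₁ → Prop} {P₂ : ρ₂ → Prop} {P₃ : ρ₃ → Prop} {Q₁ : σ₁ → Prop} {Q₂ : σ₂ → Prop}
    {Q₃ : σ₃ → Prop}
    (h : IsIsolatedThird S A B C P₁ P₂ P₃) (h₁ : IsIsolatedThird S₁ A₁ B₁ C₁ Q₁ Q₂ Q₃) :
    IsIsolatedThird (kroneckerTensor S S₁)
      (fun (x : ρ₁ × σ₁) (a : ι × ι₁) => A x.1 a.1 * A₁ x.2 a.2)
      (fun (y : ρ₂ × σ₂) (b : κ × κ₁) => B y.1 b.1 * B₁ y.2 b.2)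
      (fun (z : ρ₃ × σ₃) (c : μ × μ₁) => C z.1 c.1 * C₁ z.2 c.2)
      (fun x => P₁ x.1 ∧ Q₁ x.2) (fun y => P₂ y.1 ∧ Q₂ y.2) (fun z => P₃ z.1 ∧ Q₃ z.2) := by
  intro x y z hz hxy
  rw [sum_kronecker_block_eq]
  by_cases hfst : P₁ x.1 ∧ P₂ y.1
  · have hsnd : ¬(Q₁ x.2 ∧ Q₂ y.2) := fun hq => hxy ⟨⟨hfst.1, hq.1⟩, ⟨hfst.2, hq.2⟩⟩
    rw [h₁ x.2 y.2 z.2 hz.2 hsnd, mul_zero]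
  · rw [h x.1 y.1 z.1 hz.1 hfst, zero_mul]

end AlmanLi2026

end Literature.Computability.AlgebraicComplexity
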